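import Summits.CriticalPhenomena.PercolationContinuityZ3.Theorems.PercNearOneGluingNoHeavyLowerTailCoreAttractionSep
import Summits.CriticalPhenomena.PercolationContinuityZ3.Theorems.PercNearOneGluingNoHeavyLowerTailCoreRepulsionSep
import Summits.CriticalPhenomena.PercolationContinuityZ3.Theorems.PercNearOneGluingNoHeavyLowerTailCoreExchangeOddsShift
import HarnessLib

/-!
# `NoHeavyLowerTail` (stmt-CriticalPhenomena-4575) — the random-core pair exchange RC1, settled

Support file (prover `prim-lf-1`, lemma factory #1; `--supports stmt-CriticalPhenomena-4575`).  No definitions,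
no named facts, no sorries, no hypotheses beyond `c ∈ R`.

The floating-sink line of the seat memo (run/shared/lean/prim/prim-lf-1/CANDIDATES.md, batches 1–10) replaces the
sink vertex of the k-cluster calculus by a RANDOM CORE: a finite vertex set `R` (anchor `c ∈ R`) that must be
internally connected, `Γ = ⋂_{r ∈ R} {c ↔ r}`.  Its central conjecture was the random-core pair exchange
  (RC1)  `S_a · S_b ≤ T_a · T_b`,  `S_a = μ(Γ ∩ {o↮a} ∩ {o↮c} ∩ {o↔b})`, `T_a = μ(Γ ∩ {o↮a} ∩ {a↮c})`
(0 violations in the complete ttrl census, run/shared/lean/ttrl/lf1/README.md; a theorem on Steiner-free supports,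
`CoreExchange.steinerFree_corePairExchange`).  This file PROVES (RC1) for every finite weighted graph and every core,
and with it the floating-sink event gluing REG₂ and worst-first packing RWF₂ (`CoreExchange.eventGluing_pair_within`,
`worstFirst_two_mul_within`), by assembling three landed pieces:
* `CoreAttractionSep.coreAttraction_sep` (T2, the o/core-table minor `D(o:B<NA; R:B<FA)`): given `Γ ∩ {a↮b}`,
  `P(o↔b | b ∉ C_R) ≤ P(o↔b)`;
* `CoreRepulsionSep.coreRepulsion_sep` ((β), the minor `D(o:B<NA; R:BF<A)`): given `Γ ∩ {a↮b}`,
  `P(o↔b) ≤ P(o↔b | a ∉ C_R)`;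
* chaining the two conditional probabilities is the one-sided odds shift (T3) `P(o↔b | b ∉ C_R) ≤ P(o↔b | a ∉ C_R)`
  (`oddsShift` below, real-number bookkeeping `oddsShift_real`), and `CoreExchange.corePairExchange_of_oddsShift`
  (`…CoreExchangeOddsShift.lean`) turns (T3_ab) ∧ (T3_ba) into (RC1).
So (RC1) lies in the multiplicative closure of van den Berg–Häggström–Kahn's Theorem 1.3 rows and Harris'
inequality (each of T2, (β) is a product of three such rows) — consistent with the ttrl certificate search
(run/shared/lean/ttrl/wf3lp/README.md: "RC1 m=2: no pseudo-law").
-/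

noncomputable section

namespace Summit.CriticalPhenomena.PercolationContinuityZ3.Theorems

open MeasureTheory Set Literature.Probability.LatticeModels Literature.Probability.Percolation
open scoped Classical BigOperators

namespace CoreExchange

variable {n : ℕ}

/-- Real-number bookkeeping of the odds-shift chain: with `S = AB + A₁ = AA + A₂` (the mass of `{o↔b}`) and
`N = NB + N₁ = NA + N₂` (the mass of `{o↮b}`; all masses but `AA` need to be nonnegative), the rows `A₁·NB ≤ AB·N₁` (T2) and `AA·N₂ ≤ A₂·NA` (β) give
`A₁·N₂ ≤ A₂·N₁` (T3). [this file] -/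
theorem oddsShift_real {A₁ N₁ A₂ N₂ AB NB AA NA : ℝ} (hA₁ : 0 ≤ A₁) (hN₁ : 0 ≤ N₁) (hA₂ : 0 ≤ A₂) (hN₂ : 0 ≤ N₂)
    (hAB : 0 ≤ AB) (hNB : 0 ≤ NB) (hNA : 0 ≤ NA)
    (hS : AB + A₁ = AA + A₂) (hN : NB + N₁ = NA + N₂)
    (t2 : A₁ * NB ≤ AB * N₁) (hβ : AA * N₂ ≤ A₂ * NA) : A₁ * N₂ ≤ A₂ * N₁ := by
  set S := AB + A₁ with hSdef
  set N := NB + N₁ with hNdef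
  have k1 : A₁ * N ≤ S * N₁ := by rw [hSdef, hNdef]; nlinarith [t2]
  have k2 : S * N₂ ≤ A₂ * N := by rw [hS, hN]; nlinarith [hβ]
  have hS0 : 0 ≤ S := by rw [hSdef]; linarith
  have hN0 : 0 ≤ N := by rw [hNdef]; linarith
  by_cases hS' : S = 0
  · have : A₁ = 0 := by linarith [hS'.symm ▸ hSdef]
    rw [this, zero_mul]; exact mul_nonneg hA₂ hN₁
  by_cases hN' : N = 0
  · have : N₂ = 0 := by linarith [hN'.symm ▸ hN]
    rw [this, mul_zero]; exact mul_nonneg hA₂ hN₁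
  have hSpos : 0 < S := lt_of_le_of_ne hS0 (Ne.symm hS')
  have hNpos : 0 < N := lt_of_le_of_ne hN0 (Ne.symm hN')
  have k3 : (A₁ * N₂) * (S * N) ≤ (A₂ * N₁) * (S * N) := by
    have := mul_le_mul k1 k2 (mul_nonneg hS0 hN₂) (mul_nonneg hS0 hN₁)
    nlinarith [this]
  exact le_of_mul_le_mul_right k3 (mul_pos hSpos hNpos)

/-- For `c ∈ R`: "the core is connected and `b` is joined to its anchor" is "`R ⊆ C_b`",
`(⋂_{r∈R} {c↔r}) ∩ {b↔c} = ⋂_{r∈R} {b↔r}`. [folklore] -/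
theorem core_inter_openConn_eq {V : Type*} {c : V} {R : Finset V} (hc : c ∈ R) (b : V) :
    (⋂ r ∈ R, (openConn c r : Set (BondConfig V))) ∩ openConn b c = ⋂ r ∈ R, (openConn b r : Set (BondConfig V)) := by
  ext ω
  simp only [mem_inter_iff, mem_iInter]
  constructor
  · rintro ⟨hR, hbc⟩ r hr
    exact (show (openGraph ω).Reachable b c from hbc).trans (hR r hr)
  · intro h
    have hbc : (openGraph ω).Reachable b c := h c hc
    exact ⟨fun r hr => hbc.symm.trans (h r hr), hbc⟩

/-- **The one-sided odds shift (T3_ab), proved.**  For a core `R` with anchor `c ∈ R`, `Γ = ⋂_{r∈R} {c↔r}`,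
`D = {a ↮ b}`:
`μ(ΓD ∩ {o↔b} ∩ {b↮c}) · μ(ΓD ∩ {o↮b} ∩ {a↮c}) ≤ μ(ΓD ∩ {o↔b} ∩ {a↮c}) · μ(ΓD ∩ {o↮b} ∩ {b↮c})`
("learning `o ∈ C_b` lowers the odds 'core avoids b : core avoids a'").  Proof: `coreAttraction_sep` (T2) and
`coreRepulsion_sep` (β) chained through the unconditional `P(o↔b | ΓD)` (`oddsShift_real`). [this file] -/
theorem oddsShift (w : Sym2 (Fin n) → unitInterval) (o a b : Fin n) {c : Fin n} {R : Finset (Fin n)} (hc : c ∈ R) :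
    (prodBernoulli w).real ((⋂ r ∈ R, (openConn c r : Set (BondConfig (Fin n)))) ∩
        (openConn a b : Set (BondConfig (Fin n)))ᶜ ∩ openConn o b ∩ (openConn b c)ᶜ) *
        (prodBernoulli w).real ((⋂ r ∈ R, (openConn c r : Set (BondConfig (Fin n)))) ∩
          (openConn a b : Set (BondConfig (Fin n)))ᶜ ∩ (openConn o b)ᶜ ∩ (openConn a c)ᶜ) ≤
      (prodBernoulli w).real ((⋂ r ∈ R, (openConn c r : Set (BondConfig (Fin n)))) ∩
          (openConn a b : Set (BondConfig (Fin n)))ᶜ ∩ openConn o b ∩ (openConn a c)ᶜ) *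
        (prodBernoulli w).real ((⋂ r ∈ R, (openConn c r : Set (BondConfig (Fin n)))) ∩
          (openConn a b : Set (BondConfig (Fin n)))ᶜ ∩ (openConn o b)ᶜ ∩ (openConn b c)ᶜ) := by
  set μ := prodBernoulli w with hμ
  set Γ : Set (BondConfig (Fin n)) := ⋂ r ∈ R, (openConn c r : Set (BondConfig (Fin n))) with hΓ
  set D : Set (BondConfig (Fin n)) := (openConn a b : Set (BondConfig (Fin n)))ᶜ with hD
  set Ob : Set (BondConfig (Fin n)) := openConn o b with hOb
  set Bc : Set (BondConfig (Fin n)) := openConn b c with hBc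
  set Ac : Set (BondConfig (Fin n)) := openConn a c with hAc
  set HB : Set (BondConfig (Fin n)) := ⋂ r ∈ R, (openConn b r : Set (BondConfig (Fin n))) with hHB
  set HA : Set (BondConfig (Fin n)) := ⋂ r ∈ R, (openConn a r : Set (BondConfig (Fin n))) with hHA
  have hΓB : Γ ∩ Bc = HB := core_inter_openConn_eq hc b
  have hΓA : Γ ∩ Ac = HA := core_inter_openConn_eq hc a
  have hba : (openConn b a : Set (BondConfig (Fin n))) = openConn a b := Set.ext fun ω =>
    ⟨fun h => SimpleGraph.Reachable.symm h, fun h => SimpleGraph.Reachable.symm h⟩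
  have hbo : (openConn b o : Set (BondConfig (Fin n))) = openConn o b := Set.ext fun ω =>
    ⟨fun h => SimpleGraph.Reachable.symm h, fun h => SimpleGraph.Reachable.symm h⟩
  -- T2 and (β), in the present notation
  have t2 := CoreAttractionSep.coreAttraction_sep w o a b c R
  have hb := CoreRepulsionSep.coreRepulsion_sep w o a b c R
  rw [hba, hbo] at t2
  change μ.real (D ∩ (Γ ∩ Ob ∩ Bcᶜ)) * μ.real (D ∩ (Obᶜ ∩ HB)) ≤ μ.real (D ∩ (Ob ∩ HB)) * μ.real (D ∩ (Γ ∩ Obᶜ ∩ Bcᶜ))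
    at t2
  change μ.real (D ∩ (Ob ∩ HA)) * μ.real (D ∩ (Γ ∩ Obᶜ ∩ Acᶜ)) ≤ μ.real (D ∩ (Γ ∩ Ob ∩ Acᶜ)) * μ.real (D ∩ (Obᶜ ∩ HA))
    at hb
  -- the eight masses as cells of `E = Γ ∩ D` split by `Ob` and by `Bc` / `Ac`
  have eA₁ : Γ ∩ D ∩ Ob ∩ Bcᶜ = D ∩ (Γ ∩ Ob ∩ Bcᶜ) := by ext x; simp only [mem_inter_iff, mem_compl_iff]; tauto
  have eN₁ : Γ ∩ D ∩ Obᶜ ∩ Bcᶜ = D ∩ (Γ ∩ Obᶜ ∩ Bcᶜ) := by ext x; simp only [mem_inter_iff, mem_compl_iff]; tauto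
  have eA₂ : Γ ∩ D ∩ Ob ∩ Acᶜ = D ∩ (Γ ∩ Ob ∩ Acᶜ) := by ext x; simp only [mem_inter_iff, mem_compl_iff]; tauto
  have eN₂ : Γ ∩ D ∩ Obᶜ ∩ Acᶜ = D ∩ (Γ ∩ Obᶜ ∩ Acᶜ) := by ext x; simp only [mem_inter_iff, mem_compl_iff]; tauto
  have eAB : Γ ∩ D ∩ Ob ∩ Bc = D ∩ (Ob ∩ HB) := by
    rw [← hΓB]; ext x; simp only [mem_inter_iff]; tauto
  have eNB : Γ ∩ D ∩ Obᶜ ∩ Bc = D ∩ (Obᶜ ∩ HB) := by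
    rw [← hΓB]; ext x; simp only [mem_inter_iff, mem_compl_iff]; tauto
  have eAA : Γ ∩ D ∩ Ob ∩ Ac = D ∩ (Ob ∩ HA) := by
    rw [← hΓA]; ext x; simp only [mem_inter_iff]; tauto
  have eNA : Γ ∩ D ∩ Obᶜ ∩ Ac = D ∩ (Obᶜ ∩ HA) := by
    rw [← hΓA]; ext x; simp only [mem_inter_iff, mem_compl_iff]; tauto
  -- the two splittings of `μ(ΓD ∩ Ob)` and of `μ(ΓD ∩ Obᶜ)`
  have sB := measureReal_inter_add_inter_compl' w (Γ ∩ D ∩ Ob) Bc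
  have sA := measureReal_inter_add_inter_compl' w (Γ ∩ D ∩ Ob) Ac
  have sB' := measureReal_inter_add_inter_compl' w (Γ ∩ D ∩ Obᶜ) Bc
  have sA' := measureReal_inter_add_inter_compl' w (Γ ∩ D ∩ Obᶜ) Ac
  rw [eAB, eA₁] at sB
  rw [eAA, eA₂] at sA
  rw [eNB, eN₁] at sB'
  rw [eNA, eN₂] at sA'
  rw [eA₁, eN₂, eA₂, eN₁]
  exact oddsShift_real measureReal_nonneg measureReal_nonneg measureReal_nonneg measureReal_nonneg
    measureReal_nonneg measureReal_nonneg measureReal_nonneg (sB.trans sA.symm) (sB'.trans sA'.symm) t2 hb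

/-- **RC1′ (the x4 form), proved**: with `E = Γ ∩ {a↮b}`, `Γ = ⋂_{r∈R}{c↔r}`, `c ∈ R`:
`μ(E ∩ {o↔b} ∩ {b↮c}) · μ(E ∩ {o↔a} ∩ {a↮c}) ≤ μ(E ∩ {o↔b} ∩ {a↮c}) · μ(E ∩ {o↔a} ∩ {b↮c})` — "o ∈ C_b (rather than C_a)
makes the connected core lean to b's side" (seat memo BATCH 8 (8a)).  From `oddsShift` twice and
`corePairExchangePrime_of_oddsShift`. [this file] -/
theorem corePairExchangePrime (w : Sym2 (Fin n) → unitInterval) (o a b : Fin n) {c : Fin n} {R : Finset (Fin n)}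
    (hc : c ∈ R) :
    (prodBernoulli w).real ((⋂ r ∈ R, (openConn c r : Set (BondConfig (Fin n)))) ∩
        (openConn a b : Set (BondConfig (Fin n)))ᶜ ∩ openConn o b ∩ (openConn b c)ᶜ) *
        (prodBernoulli w).real ((⋂ r ∈ R, (openConn c r : Set (BondConfig (Fin n)))) ∩
          (openConn a b : Set (BondConfig (Fin n)))ᶜ ∩ openConn o a ∩ (openConn a c)ᶜ) ≤
      (prodBernoulli w).real ((⋂ r ∈ R, (openConn c r : Set (BondConfig (Fin n)))) ∩
          (openConn a b : Set (BondConfig (Fin n)))ᶜ ∩ openConn o b ∩ (openConn a c)ᶜ) *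
        (prodBernoulli w).real ((⋂ r ∈ R, (openConn c r : Set (BondConfig (Fin n)))) ∩
          (openConn a b : Set (BondConfig (Fin n)))ᶜ ∩ openConn o a ∩ (openConn b c)ᶜ) := by
  have h₁ := oddsShift w o a b hc
  have h₂ := oddsShift w o b a hc
  have hba : (openConn b a : Set (BondConfig (Fin n))) = openConn a b := Set.ext fun ω =>
    ⟨fun h => SimpleGraph.Reachable.symm h, fun h => SimpleGraph.Reachable.symm h⟩
  rw [hba] at h₂
  have key := corePairExchangePrime_of_oddsShift w
    ((⋂ r ∈ R, (openConn c r : Set (BondConfig (Fin n)))) ∩ (openConn a b : Set (BondConfig (Fin n)))ᶜ)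
    (openConn o b) (openConn o a) (openConn b c) (openConn a c)
    (by simpa only [inter_assoc] using h₁) (by simpa only [inter_assoc] using h₂)
  simpa only [inter_assoc] using key

/-- **The random-core pair exchange (RC1), proved** (seat memo CANDIDATES.md batch 1; the `k' = 2` floating-sink
C⁺).  For an observer `o`, floating relays `a, b` and a core `R` with anchor `c ∈ R`, `Γ = ⋂_{r∈R} {c↔r}`:
`μ(Γ ∩ {o↮a} ∩ {o↮c} ∩ {o↔b}) · μ(Γ ∩ {o↮b} ∩ {o↮c} ∩ {o↔a}) ≤ μ(Γ ∩ {o↮a} ∩ {a↮c}) · μ(Γ ∩ {o↮b} ∩ {b↮c})`,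
i.e. `S_a · S_b ≤ T_a · T_b` with the sink of `Theorems.worstPairExchange_two` replaced by the random core.
Proof: `oddsShift` for `(a, b)` and for `(b, a)`, then `corePairExchange_of_oddsShift`. [this file] -/
theorem corePairExchange (w : Sym2 (Fin n) → unitInterval) (o a b : Fin n) {c : Fin n} {R : Finset (Fin n)}
    (hc : c ∈ R) :
    (prodBernoulli w).real ((⋂ r ∈ R, (openConn c r : Set (BondConfig (Fin n)))) ∩
        (openConn o a : Set (BondConfig (Fin n)))ᶜ ∩ (openConn o c)ᶜ ∩ openConn o b) *
        (prodBernoulli w).real ((⋂ r ∈ R, (openConn c r : Set (BondConfig (Fin n)))) ∩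
          (openConn o b : Set (BondConfig (Fin n)))ᶜ ∩ (openConn o c)ᶜ ∩ openConn o a) ≤
      (prodBernoulli w).real ((⋂ r ∈ R, (openConn c r : Set (BondConfig (Fin n)))) ∩
          (openConn o a : Set (BondConfig (Fin n)))ᶜ ∩ (openConn a c)ᶜ) *
        (prodBernoulli w).real ((⋂ r ∈ R, (openConn c r : Set (BondConfig (Fin n)))) ∩
          (openConn o b : Set (BondConfig (Fin n)))ᶜ ∩ (openConn b c)ᶜ) := by
  have h₁ := oddsShift w o a b hc
  have h₂ := oddsShift w o b a hc
  have hba : (openConn b a : Set (BondConfig (Fin n))) = openConn a b := Set.ext fun ω =>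
    ⟨fun h => SimpleGraph.Reachable.symm h, fun h => SimpleGraph.Reachable.symm h⟩
  rw [hba] at h₂
  exact corePairExchange_of_oddsShift w _ o a b c h₁ h₂

/-- **Floating-sink event gluing for two relays (REG₂), proved**: for `a ≠ b`, a core `R` with anchor `c ∈ R`,
`Γ = ⋂_{r∈R}{c↔r}`, if `μ(Γ ∩ {a↮c}) ≤ s` and `μ(Γ ∩ {b↮c}) ≤ s` then `μ(Γ ∩ {o↮c} ∩ ({o↔a} ∪ {o↔b})) ≤ s`
— event gluing with the sink replaced by a random connected core (seat memo RC2, `k' = 2`). [this file] -/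
theorem coreEventGluing_pair (w : Sym2 (Fin n) → unitInterval) (o : Fin n) {a b c : Fin n} {R : Finset (Fin n)}
    (hc : c ∈ R) (hab : a ≠ b) (s : ℝ)
    (ha : (prodBernoulli w).real ((⋂ r ∈ R, (openConn c r : Set (BondConfig (Fin n)))) ∩
      (openConn a c : Set (BondConfig (Fin n)))ᶜ) ≤ s)
    (hb : (prodBernoulli w).real ((⋂ r ∈ R, (openConn c r : Set (BondConfig (Fin n)))) ∩
      (openConn b c : Set (BondConfig (Fin n)))ᶜ) ≤ s) :
    (prodBernoulli w).real ((⋂ r ∈ R, (openConn c r : Set (BondConfig (Fin n)))) ∩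
      (openConn o c : Set (BondConfig (Fin n)))ᶜ ∩ ⋃ y ∈ ({a, b} : Finset (Fin n)), openConn o y) ≤ s :=
  coreEventGluing_pair_of_oddsShift w _ o a b c hab s (oddsShift w o a b hc)
    (by
      have h₂ := oddsShift w o b a hc
      have hba : (openConn b a : Set (BondConfig (Fin n))) = openConn a b := Set.ext fun ω =>
        ⟨fun h => SimpleGraph.Reachable.symm h, fun h => SimpleGraph.Reachable.symm h⟩
      rw [hba] at h₂; exact h₂) ha hb

/-- **Floating-sink worst-first packing for two relays (RWF₂), proved**: for a core `R` with anchor `c ∈ R`,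
`Γ = ⋂_{r∈R}{c↔r}`, and `a` the worse relay (`μ(Γ ∩ {b↮c}) ≤ μ(Γ ∩ {a↮c})`):
`μ(Γ ∩ {a↮c}) · μ(Γ ∩ {o↮a} ∩ {o↮c} ∩ {o↔b}) ≤ μ(Γ ∩ {b↮c}) · μ(Γ ∩ {o↮a} ∩ {a↮c})`
(seat memo RC3, `k' = 2`). [this file] -/
theorem coreWorstFirst_two_mul (w : Sym2 (Fin n) → unitInterval) (o a b : Fin n) {c : Fin n} {R : Finset (Fin n)}
    (hc : c ∈ R)
    (hworse : (prodBernoulli w).real ((⋂ r ∈ R, (openConn c r : Set (BondConfig (Fin n)))) ∩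
        (openConn b c : Set (BondConfig (Fin n)))ᶜ) ≤
      (prodBernoulli w).real ((⋂ r ∈ R, (openConn c r : Set (BondConfig (Fin n)))) ∩
        (openConn a c : Set (BondConfig (Fin n)))ᶜ)) :
    (prodBernoulli w).real ((⋂ r ∈ R, (openConn c r : Set (BondConfig (Fin n)))) ∩
        (openConn a c : Set (BondConfig (Fin n)))ᶜ) *
        (prodBernoulli w).real ((⋂ r ∈ R, (openConn c r : Set (BondConfig (Fin n)))) ∩
          (openConn o a : Set (BondConfig (Fin n)))ᶜ ∩ (openConn o c)ᶜ ∩ openConn o b) ≤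
      (prodBernoulli w).real ((⋂ r ∈ R, (openConn c r : Set (BondConfig (Fin n)))) ∩
          (openConn b c : Set (BondConfig (Fin n)))ᶜ) *
        (prodBernoulli w).real ((⋂ r ∈ R, (openConn c r : Set (BondConfig (Fin n)))) ∩
          (openConn o a : Set (BondConfig (Fin n)))ᶜ ∩ (openConn a c)ᶜ) :=
  coreWorstFirst_two_mul_of_oddsShift w _ o a b c (oddsShift w o a b hc)
    (by
      have h₂ := oddsShift w o b a hc
      have hba : (openConn b a : Set (BondConfig (Fin n))) = openConn a b := Set.ext fun ω =>
        ⟨fun h => SimpleGraph.Reachable.symm h, fun h => SimpleGraph.Reachable.symm h⟩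
      rw [hba] at h₂; exact h₂) hworse

end CoreExchange

end Summit.CriticalPhenomena.PercolationContinuityZ3.Theorems

end
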